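import Summits.QuantumFields.YangMills.Theorems.BalabanUVNodesN14ClassLawRoadsAtSpineReadingOfRecord13CoPHV
import Summits.QuantumFields.YangMills.Theorems.BalabanUVNodesN19ShapeFaceN14AtRecordSharp

/-!
# BalabanUVNodes ∕ N14 — THE SHAPE-CURRENCY SHARP EDITION of N14's (I)-binder and of N19′'s explicit-rate core AT THE SPINE READINGS OF RECORD
# `crOfRecord₁₃At ∕ crOfRecord₁₃VAt K₀ jcut sh`: the LINEAR rate `η_K = r_K` (dag-n19-w2 g2 over dag-n14-w3's sharp tilt engine), and what it buys on the (I)-road —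
# from the SAME displayed inputs MASS_cl(`r₁`) ∧ SHAPE_cl(`r₂`) the (I)-road core has exponent width `r₁ + r₂`, where the class-sandwich road (iii)″ displays `r₁ + 2r₂`

Cell `pub-ymgap` (HUMAN RULING D-0062 Track A; director-ym №197 ∕ HUMAN RULING D-0149 width push), WIDTH SEAT `pub-ymgap-dag-n14-w2` (g4, harness re-seat), payload «N14 DEPENDENT
on §N19 s1 ∕ U3 — take N19-side typed sub-lemmas by name»; bus CLAIM-2 ∕ INTENT-2.  The SHAPE-currency companion of this seat's FILE 1 p605687 `…CoPHSharp` (TV currency):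
dag-n19-w2 g2's linear-rate SHAPE face `N19ShapeFaceN14AtRecordSharp.tiltedMeanMatching_of_shapeDensity_atKeys_linear` (p598…, over dag-n14-w3's `YMDAG.N14.SharpTilt` engine
p593248 ∕ p594573) carried BY NAME to the spine readings of record, and the (I)-road core with the rate DISPLAYED in SHAPE words.  Filed `--kind proof --supports
stmt-QuantumFields-20544 --as helper` (K3⁷ `SpineGivenEndpointR13SepCoPH`; skeleton v5 941dddb108cbaacf UNTOUCHED — texts below the skeleton key).  COUNT-NEUTRAL.  THEOREMS
ONLY (0 `def`).  Imports g3 FILE 1 p599679 `…N14ClassLawRoadsAtSpineReadingOfRecord13CoPHV` (⇒ p593287 ∕ p594686 ∕ p596111) and dag-n19-w2's `…N19ShapeFaceN14AtRecordSharp`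
ONLY; nothing of theirs re-declared or edited.

WHAT IS PROVED (binder prefixes of the parents VERBATIM; `N`-, `K₀`-, `jcut`-, `sh`-generic).
* §0 `coreZero_of_massSandwich_mgfForm` (generic, two field spaces): MGF forms of the two shell-free cores + MASS_cl(`r₁`) in mass form (ONE constant `c_K`: `e^{c − r₁ K}·|ν_A| ≤
  |ν_B| ≤ e^{c + r₁ K}·|ν_A|` on every good class) ⇒ the VACUUM bracket `NE7.Core l₀ vol T Bad P(·,0,·) Q(·,0,·) (K ↦ r₁ K ∕ vol)` (`MGFForm.zero_eq`; the measure-words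
  reading of (V), cf. g3 FILE 1 `coreZero_iff_massSandwich`).
* §1 `tiltedMeanMatching_crOfRecord₁₃At_of_shapeDensity_linear` ∕ `tiltedMeanMatching_crOfRecord₁₃VAt_of_shapeDensity_linear`: U3's read-out sentence in SHAPE currency,
  density form (`hSh`: on every good key the pushed-forward class law of run B IS `e^{c}` times run A's with a density `e^{g}`, `g` measurable, `|g| ≤ r K`, `0 ≤ r K`) ⇒
  N14's binder at the reading with `η K = r K` — `l₀`-FREE (p596111 §1 displayed `e^{2 r K} − 1`).
* §2 ★ `core_reading₁₃_of_coreZero_of_shapeDensity_linear`: (V) `δ₀` + (SH) the shell split in MGF-part form + (I) SHAPE_cl on the SHELL-FREE class laws ⇒ `NE7.Core 1 1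
  (classSet₁₃ …) (badClass₁₃ … jcut) (weightA₁₃ − sh.1) (weightB₁₃ − sh.2) (K ↦ δ₀ K + r K)`; ★ `core_readingV₁₃_of_coreZero_of_shapeDensity_linear` (volume letter
  `F.side ^ 4`: `K ↦ δ₀ K + (1 ∕ F.side⁴)·r K`); `core_readingV₁₃_shellSplitOfRecord_of_coreZero_of_shapeDensity_linear` ((SH) DISCHARGED at n21-d's
  `shellSplitOfRecord₁₃At N K₀ ρA ρB` by the shell sibling p594686 BY NAME).
* §3 ★★ `core_readingV₁₃_shellSplitOfRecord_of_massSandwich_of_shapeDensity_linear`: the SAME displayed inputs as g3 FILE 1 §4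
  `core_crOfRecord₁₃VAt_shellSplitOfRecord_of_massSandwich_of_shapeDensity` — MASS_cl(`r₁`) ∧ SHAPE_cl(`r₂`) of the SHELL-FREE class laws of record at n21-d's shell split —
  now on N14's (I)-ROAD (§0 ⇒ vacuum bracket `r₁ ∕ F.side⁴`; §1's linear binder; dag-n19-d's join `core_of_coreZero_mgfForm`) ⇒ `NE7.Core 1 (F.side⁴) … (K ↦ (r₁ K + r₂ K) ∕
  F.side⁴)`: exponent width `r₁ + r₂`.  Road (iii)″ (dag-n19-c `classSandwich_of_mass_of_shape` ∘ `core_of_classSandwich`, which does NOT read N14's binder) displays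
  `r₁ + 2r₂` from the same inputs.  LOCATED (count-neutral): in SHAPE currency the (I)-binder road is the TIGHTER typed road to the N19′ core at the reading of record (by `r₂`;
  it scales with `l₀`), whereas in TV currency n19-c's direct road `r₁ + (e² − 1)ρ` beats the binder road `r₁ + 2e²ρ` (FILE 1); the ∃-literals K3⁷ reads (canonical `δ`,
  `Summable`) are the same on every road and are NOT re-typed here (g3 FILE 1 §4 is that statement).

HONEST FRAMING.  Count-neutral by-name knit + one [folklore] mass lemma.  ZERO ESTIMATE CONTENT: `hM` (MASS_cl), `hSh` (SHAPE_cl in density form), (V) `h0` and the shell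
split's MGF-part form are HYPOTHESIS SHAPES produced by nobody — UNPRINTED two-run statements for d = 4 (node U3 ∕ §N19 s1's world); the live-selector pin and the laws
(H-ζ) ∕ `0 ≤ ζ` are displayed, claimed for no tuple (K0⁷ OPEN); nothing of Bałaban's is asserted; NE7 ∕ NE1′ NOT PRINTED as two-run statements and NOT PROVED; N14 ∕ N19 ∕
N21 NOT discharged; K3⁷ OPEN, NOT claimed; counts UNMOVED (typed 28∕28 · discharged 5∕27, A 5∕28); no count claim.  One finite four-torus programme at fixed `ε = L^{−K}`,
Bałaban AS PRINTED — the YM mass gap (Clay) is NOT proved by any of this: R4 closes only the conditional finite-𝕋⁴ rung `BalabanLadder.UV`; NOT ℝ⁴, NOT OS, NOT a mass gap,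
NOT Clay.  0 `def`, 0 `sorry`, standard axioms, no `instance`, no `notation`; no decl below carries a cite tag (bookkeeping [folklore]).
-/

set_option autoImplicit false

noncomputable section

open MeasureTheory ProbabilityTheory Finset
open scoped ENNReal BigOperators Matrix.Norms.L2Operator

namespace YMDAG.N14.AtSpineReading13CoPH.SharpShape

open Literature.MathematicalPhysics.QuantumFieldTheory.Balaban1983to89
open Literature.MathematicalPhysics.QuantumFieldTheory.Balaban1983to89.T4Continuum
open Literature.MathematicalPhysics.QuantumFieldTheory.Balaban1983to89.Node00
open B14.Eq218Concrete
open Summit.QuantumFields.BalabanUV.T4Continuum.Spine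
open Summit.QuantumFields.BalabanUV.T4Continuum.NE1p.DressedMGFForm (MGFForm TiltedMeanMatching)
open Summit.QuantumFields.YangMills.BalabanUVNodes.N19ShapeFaceN14AtRecordSharp (tiltedMeanMatching_of_shapeDensity_atKeys_linear)
open Summit.QuantumFields.YangMills.BalabanUVNodes.N19VacuumMGFRoad (core_of_coreZero_mgfForm)
open YMDAG.UVSplit hiding SU
open YMDAG.N14.AtSpineReading13CoPH

/-! ## §0 MASS_cl ⇒ the vacuum bracket (generic; the two runs live on different field spaces) -/

section Generic

variable {ι : Type*} [DecidableEq ι] {ΩA ΩB : ℕ → Type*} [∀ K, MeasurableSpace (ΩA K)] [∀ K, MeasurableSpace (ΩB K)]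
  {Bo l₀ vol : ℝ} {T : ℕ → Finset ι} {Bad : ℕ → ℝ → Finset ι} {Fo : ∀ K, ΩA K → ℝ} {ν : ∀ K, ι → Measure (ΩA K)}
  {Fo' : ∀ K, ΩB K → ℝ} {ν' : ∀ K, ι → Measure (ΩB K)} {P Q : ℕ → ℝ → ι → ℝ} {r₁ : ℕ → ℝ}

/-- **MASS_cl ⇒ (V), GENERIC** [bookkeeping]: if the shell-free cores `P` (run A) and `Q` (run B) are MGFs over finite measures `ν ∕ ν'` on the runs' OWN field spaces and, for every
`K`, ONE constant `c` sandwiches the MASSES of the good classes — `e^{c − r₁ K}·ν(univ) ≤ ν'(univ) ≤ e^{c + r₁ K}·ν(univ)` (mass form, `ℝ≥0∞`) — then the VACUUM cores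
`t ↦ P K 0 τ`, `t ↦ Q K 0 τ` carry `NE7.Core l₀ vol T Bad … (K ↦ r₁ K ∕ vol)` (`0 < vol`): the undressed total is the mass (`MGFForm.zero_eq`). [folklore] -/
theorem coreZero_of_massSandwich_mgfForm (hvol : 0 < vol) (hP : MGFForm Bo T Fo ν P) (hQ : MGFForm Bo T Fo' ν' Q)
    (hM : ∀ K : ℕ, ∃ c : ℝ, ∀ t : ℝ, |t| ≤ l₀ → ∀ τ ∈ T K \ Bad K t,
      ENNReal.ofReal (Real.exp (c - r₁ K)) * ν K τ Set.univ ≤ ν' K τ Set.univ ∧ ν' K τ Set.univ ≤ ENNReal.ofReal (Real.exp (c + r₁ K)) * ν K τ Set.univ) :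
    NE7.Core l₀ vol T Bad (fun K _ τ => P K 0 τ) (fun K _ τ => Q K 0 τ) fun K => r₁ K / vol := by
  intro K
  obtain ⟨c, hc⟩ := hM K
  refine ⟨c, fun t ht τ hτ => ?_⟩
  have hτT : τ ∈ T K := (Finset.mem_sdiff.1 hτ).1
  haveI := hP.finite K τ hτT
  haveI := hQ.finite K τ hτT
  obtain ⟨h1, h2⟩ := hc t ht τ hτ
  dsimp only
  rw [mul_div_cancel₀ _ hvol.ne', hP.zero_eq K hτT, hQ.zero_eq K hτT]
  refine ⟨?_, ?_⟩
  · have h := ENNReal.toReal_mono (measure_ne_top (ν' K τ) _) h1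
    rw [ENNReal.toReal_mul, ENNReal.toReal_ofReal (Real.exp_pos _).le] at h
    exact h
  · have h := ENNReal.toReal_mono (ENNReal.mul_ne_top ENNReal.ofReal_ne_top (measure_ne_top (ν K τ) _)) h2
    rw [ENNReal.toReal_mul, ENNReal.toReal_ofReal (Real.exp_pos _).le] at h
    exact h

end Generic

variable {F : T4Family} {N : ℕ} [NeZero N] (θ : Stage13HParams F N) (hP : θ.Provisos₁₃CoPH F N) (K₀ : ℕ) (jcut : ℕ → ℕ) (sh : ShellSplit₁₃CoPH N K₀)

/-! ## §1 N14's binder at the spine readings of record, SHAPE currency, LINEAR rate (`η = r`, `l₀`-free) -/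

section Binder

/-- **N14's BINDER AT THE ₁₃ READING OF RECORD, SHAPE CURRENCY, LINEAR RATE** — U3's read-out sentence in density form `hSh` (produced by nobody): on every good key the class law of
run B pushed to the unit lattice IS `e^{c}` times run A's with a density `e^{g}`, `g` measurable, `|g| ≤ r K`, `0 ≤ r K` ⇒ `TiltedMeanMatching` at `crOfRecord₁₃At K₀ jcut sh …`'s
`l₀ ∕ T ∕ Bad` for the record's observables and class measures of record with `η K = r K` (dag-n19-w2 g2's `tiltedMeanMatching_of_shapeDensity_atKeys_linear` over dag-n14-w3's sharp
tilt engine BY NAME; p596111 §1's edition displayed `e^{2 r K} − 1`). [folklore] -/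
theorem tiltedMeanMatching_crOfRecord₁₃At_of_shapeDensity_linear (hζm : ZetaMeasurable F N θ.ζ) (g₀ : ℕ → ℝ) (os : List (ULoop F)) {r : ℕ → ℝ}
    (hSh : letI : DecidableEq (Σ K, SiteSeqKey F (K₀ + K)) := Classical.decEq _
      ∀ (K : ℕ) (t : ℝ), |t| ≤ 1 → ∀ x ∈ classSet₁₃ θ K₀ g₀ K \ badClass₁₃ θ K₀ g₀ jcut K t,
        ∃ (c : ℝ) (g : GaugeField (F.P 0) 0 (Node00.SU N) → ℝ), Measurable g ∧ (∀ u, |g u| ≤ r K) ∧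
          (classMeasB₁₃ θ K₀ g₀ K x).map
              ((T4RunLadder.unitFactorisation (datumOfRecord₁₃CoPH F N θ hP) (isPrintedAveraged_datumOfRecord₁₃CoPH F N θ hP).avgMeasurable g₀).A (K₀ + K + 1)) =
            ENNReal.ofReal (Real.exp c) •
              ((classMeasA₁₃ θ K₀ g₀ K x).map
                ((T4RunLadder.unitFactorisation (datumOfRecord₁₃CoPH F N θ hP) (isPrintedAveraged_datumOfRecord₁₃CoPH F N θ hP).avgMeasurable g₀).A (K₀ + K))).withDensity
                fun u => ENNReal.ofReal (Real.exp (g u)))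
    (hr : ∀ K, 0 ≤ r K) :
    letI := (crOfRecord₁₃At K₀ jcut sh F θ hP g₀ os).dec
    TiltedMeanMatching (crOfRecord₁₃At K₀ jcut sh F θ hP g₀ os).l₀ (crOfRecord₁₃At K₀ jcut sh F θ hP g₀ os).T (crOfRecord₁₃At K₀ jcut sh F θ hP g₀ os).Bad
      (fun K (U : GaugeField (F.P (K₀ + K)) 0 (Node00.SU N)) => T4GenFunBounds.prodObs ((datumOfRecord₁₃CoPH F N θ hP).scheme g₀) (K₀ + K) os U) (classMeasA₁₃ θ K₀ g₀)
      (fun K (U : GaugeField (F.P (K₀ + K + 1)) 0 (Node00.SU N)) => T4GenFunBounds.prodObs ((datumOfRecord₁₃CoPH F N θ hP).scheme g₀) (K₀ + K + 1) os U) (classMeasB₁₃ θ K₀ g₀)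
      r := by
  letI : DecidableEq (Σ K, SiteSeqKey F (K₀ + K)) := Classical.decEq _
  have h := tiltedMeanMatching_of_shapeDensity_atKeys_linear (T := classSet₁₃ θ K₀ g₀) (Bad := badClass₁₃ θ K₀ g₀ jcut) (l₀ := 1) (r := r)
    (kA := fun K => K₀ + K) (kB := fun K => K₀ + K + 1) (νA := classMeasA₁₃ θ K₀ g₀) (νB := classMeasB₁₃ θ K₀ g₀)
    (T4RunLadder.unitFactorisation (datumOfRecord₁₃CoPH F N θ hP) (isPrintedAveraged_datumOfRecord₁₃CoPH F N θ hP).avgMeasurable g₀) os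
    (fun K x _ => isFiniteMeasure_classMeasA₁₃ θ K₀ hP hζm g₀ K x) hSh hr
  intro K t ht x hx u hu
  exact h K t ht x hx u hu

/-- **N14's BINDER AT THE V READING OF RECORD, SHAPE CURRENCY, LINEAR RATE** `η K = r K` (the binder does not read `vol`; p596111 §1's `tiltedMeanMatching_crOfRecord₁₃VAt_of_shapeDensity`
with `e^{2 r K} − 1` replaced by `r K`). [folklore] -/
theorem tiltedMeanMatching_crOfRecord₁₃VAt_of_shapeDensity_linear (hζm : ZetaMeasurable F N θ.ζ) (g₀ : ℕ → ℝ) (os : List (ULoop F)) {r : ℕ → ℝ}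
    (hSh : letI : DecidableEq (Σ K, SiteSeqKey F (K₀ + K)) := Classical.decEq _
      ∀ (K : ℕ) (t : ℝ), |t| ≤ 1 → ∀ x ∈ classSet₁₃ θ K₀ g₀ K \ badClass₁₃ θ K₀ g₀ jcut K t,
        ∃ (c : ℝ) (g : GaugeField (F.P 0) 0 (Node00.SU N) → ℝ), Measurable g ∧ (∀ u, |g u| ≤ r K) ∧
          (classMeasB₁₃ θ K₀ g₀ K x).map
              ((T4RunLadder.unitFactorisation (datumOfRecord₁₃CoPH F N θ hP) (isPrintedAveraged_datumOfRecord₁₃CoPH F N θ hP).avgMeasurable g₀).A (K₀ + K + 1)) =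
            ENNReal.ofReal (Real.exp c) •
              ((classMeasA₁₃ θ K₀ g₀ K x).map
                ((T4RunLadder.unitFactorisation (datumOfRecord₁₃CoPH F N θ hP) (isPrintedAveraged_datumOfRecord₁₃CoPH F N θ hP).avgMeasurable g₀).A (K₀ + K))).withDensity
                fun u => ENNReal.ofReal (Real.exp (g u)))
    (hr : ∀ K, 0 ≤ r K) :
    letI := (crOfRecord₁₃VAt K₀ jcut sh F θ hP g₀ os).dec
    TiltedMeanMatching (crOfRecord₁₃VAt K₀ jcut sh F θ hP g₀ os).l₀ (crOfRecord₁₃VAt K₀ jcut sh F θ hP g₀ os).T (crOfRecord₁₃VAt K₀ jcut sh F θ hP g₀ os).Bad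
      (fun K (U : GaugeField (F.P (K₀ + K)) 0 (Node00.SU N)) => T4GenFunBounds.prodObs ((datumOfRecord₁₃CoPH F N θ hP).scheme g₀) (K₀ + K) os U) (classMeasA₁₃ θ K₀ g₀)
      (fun K (U : GaugeField (F.P (K₀ + K + 1)) 0 (Node00.SU N)) => T4GenFunBounds.prodObs ((datumOfRecord₁₃CoPH F N θ hP).scheme g₀) (K₀ + K + 1) os U) (classMeasB₁₃ θ K₀ g₀)
      r := by
  have h := tiltedMeanMatching_crOfRecord₁₃At_of_shapeDensity_linear θ hP K₀ jcut sh hζm g₀ os hSh hr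
  intro K t ht x hx u hu
  exact h K t ht x hx u hu

end Binder

/-! ## §2 ★ The (I)-road core with the rate DISPLAYED, SHAPE currency, linear rate -/

section CoreShape

/-- **★ N19′'s CORE AT THE ₁₃ READING's CARRIERS ON THE (I)-ROAD, SHAPE CURRENCY, RATE DISPLAYED** — at one Stage-13 tuple with core provisos on the live-selector line (`hsel`; laws
(H-ζ) `hζm`, `0 ≤ ζ` `hζ0`), DISPLAYED HYPOTHESES (each produced by nobody): (V) `h0` the vacuum bracket on the shell-free class weights of record, width `δ₀`; (SH) the shell split `sh`
in MGF-part form (`νshA ≤ classMeasA₁₃`, `νshB ≤ classMeasB₁₃`); (I) U3's read-out sentence in SHAPE currency, density form, for the SHELL-FREE class laws pushed to the unit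
lattice (`|g| ≤ r K`, `0 ≤ r K`).  CONCLUSION: `NE7.Core 1 1 (classSet₁₃ …) (badClass₁₃ … jcut) (weightA₁₃ − sh.1) (weightB₁₃ − sh.2) (K ↦ δ₀ K + r K)` with the vacuum bracket's
constants (`core_of_coreZero_mgfForm` over §1's engine BY NAME; `l₀ = vol = 1`).  No summability letter is read. [folklore] -/
theorem core_reading₁₃_of_coreZero_of_shapeDensity_linear (E : B12.RunParams → ℝ) (hsel : θ.ppSel = ppSelLiveOfRecord F N θ.ν θ.τ9 E (wOfRecord₉ F N θ.toStage9Params))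
    (hζm : ZetaMeasurable F N θ.ζ) (hζ0 : ∀ p g k s Pl Ql RS U V', 0 ≤ θ.ζ p g k s Pl Ql RS U V') (g₀ : ℕ → ℝ) (os : List (ULoop F)) {δ₀ r : ℕ → ℝ}
    (h0 : letI : DecidableEq (Σ K, SiteSeqKey F (K₀ + K)) := Classical.decEq _
      NE7.Core 1 1 (classSet₁₃ θ K₀ g₀) (badClass₁₃ θ K₀ g₀ jcut) (fun K _ x => weightA₁₃ θ hP K₀ g₀ os K 0 x - (sh F θ hP g₀ os).1 K 0 x)
        (fun K _ x => weightB₁₃ θ hP K₀ g₀ os K 0 x - (sh F θ hP g₀ os).2 K 0 x) δ₀)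
    {νshA : ∀ K, (Σ K, SiteSeqKey F (K₀ + K)) → Measure (GaugeField (F.P (K₀ + K)) 0 (Node00.SU N))}
    {νshB : ∀ K, (Σ K, SiteSeqKey F (K₀ + K)) → Measure (GaugeField (F.P (K₀ + K + 1)) 0 (Node00.SU N))}
    (hshA : MGFForm 1 (classSet₁₃ θ K₀ g₀)
      (fun K (U : GaugeField (F.P (K₀ + K)) 0 (Node00.SU N)) => T4GenFunBounds.prodObs ((datumOfRecord₁₃CoPH F N θ hP).scheme g₀) (K₀ + K) os U) νshA (sh F θ hP g₀ os).1)
    (hleA : ∀ K, ∀ x ∈ classSet₁₃ θ K₀ g₀ K, νshA K x ≤ classMeasA₁₃ θ K₀ g₀ K x)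
    (hshB : MGFForm 1 (classSet₁₃ θ K₀ g₀)
      (fun K (U : GaugeField (F.P (K₀ + K + 1)) 0 (Node00.SU N)) => T4GenFunBounds.prodObs ((datumOfRecord₁₃CoPH F N θ hP).scheme g₀) (K₀ + K + 1) os U) νshB (sh F θ hP g₀ os).2)
    (hleB : ∀ K, ∀ x ∈ classSet₁₃ θ K₀ g₀ K, νshB K x ≤ classMeasB₁₃ θ K₀ g₀ K x)
    (hSh : letI : DecidableEq (Σ K, SiteSeqKey F (K₀ + K)) := Classical.decEq _
      ∀ (K : ℕ) (t : ℝ), |t| ≤ 1 → ∀ x ∈ classSet₁₃ θ K₀ g₀ K \ badClass₁₃ θ K₀ g₀ jcut K t,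
        ∃ (c : ℝ) (g : GaugeField (F.P 0) 0 (Node00.SU N) → ℝ), Measurable g ∧ (∀ u, |g u| ≤ r K) ∧
          (classMeasB₁₃ θ K₀ g₀ K x - νshB K x).map
              ((T4RunLadder.unitFactorisation (datumOfRecord₁₃CoPH F N θ hP) (isPrintedAveraged_datumOfRecord₁₃CoPH F N θ hP).avgMeasurable g₀).A (K₀ + K + 1)) =
            ENNReal.ofReal (Real.exp c) •
              ((classMeasA₁₃ θ K₀ g₀ K x - νshA K x).map
                ((T4RunLadder.unitFactorisation (datumOfRecord₁₃CoPH F N θ hP) (isPrintedAveraged_datumOfRecord₁₃CoPH F N θ hP).avgMeasurable g₀).A (K₀ + K))).withDensity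
                fun u => ENNReal.ofReal (Real.exp (g u)))
    (hr : ∀ K, 0 ≤ r K) :
    letI : DecidableEq (Σ K, SiteSeqKey F (K₀ + K)) := Classical.decEq _
    NE7.Core 1 1 (classSet₁₃ θ K₀ g₀) (badClass₁₃ θ K₀ g₀ jcut) (fun K t x => weightA₁₃ θ hP K₀ g₀ os K t x - (sh F θ hP g₀ os).1 K t x)
      (fun K t x => weightB₁₃ θ hP K₀ g₀ os K t x - (sh F θ hP g₀ os).2 K t x) fun K => δ₀ K + r K := by
  letI : DecidableEq (Σ K, SiteSeqKey F (K₀ + K)) := Classical.decEq _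
  have hA := (mgfForm_weightA₁₃ θ K₀ hP E hsel hζm hζ0 g₀ os).sub hshA hleA
  have hB := (mgfForm_weightB₁₃ θ K₀ hP E hsel hζm hζ0 g₀ os).sub hshB hleB
  have h := tiltedMeanMatching_of_shapeDensity_atKeys_linear (T := classSet₁₃ θ K₀ g₀) (Bad := badClass₁₃ θ K₀ g₀ jcut) (l₀ := 1) (r := r)
    (kA := fun K => K₀ + K) (kB := fun K => K₀ + K + 1) (νA := fun K x => classMeasA₁₃ θ K₀ g₀ K x - νshA K x) (νB := fun K x => classMeasB₁₃ θ K₀ g₀ K x - νshB K x)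
    (T4RunLadder.unitFactorisation (datumOfRecord₁₃CoPH F N θ hP) (isPrintedAveraged_datumOfRecord₁₃CoPH F N θ hP).avgMeasurable g₀) os hA.finite hSh hr
  have hη : TiltedMeanMatching 1 (classSet₁₃ θ K₀ g₀) (badClass₁₃ θ K₀ g₀ jcut)
      (fun K (U : GaugeField (F.P (K₀ + K)) 0 (Node00.SU N)) => T4GenFunBounds.prodObs ((datumOfRecord₁₃CoPH F N θ hP).scheme g₀) (K₀ + K) os U)
      (fun K x => classMeasA₁₃ θ K₀ g₀ K x - νshA K x)
      (fun K (U : GaugeField (F.P (K₀ + K + 1)) 0 (Node00.SU N)) => T4GenFunBounds.prodObs ((datumOfRecord₁₃CoPH F N θ hP).scheme g₀) (K₀ + K + 1) os U)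
      (fun K x => classMeasB₁₃ θ K₀ g₀ K x - νshB K x) r := by
    intro K t ht x hx u hu
    exact h K t ht x hx u hu
  have hc := core_of_coreZero_mgfForm one_pos hA hB h0 hη
  simp only [div_one, one_mul] at hc
  exact hc

/-- **★ N19′'s CORE AT THE V READING's CARRIERS ON THE (I)-ROAD, SHAPE CURRENCY, RATE DISPLAYED** — the same with (V) displayed at volume `F.side ^ 4`: `NE7.Core 1 (F.side ^ 4) …
(K ↦ δ₀ K + (1 ∕ F.side⁴)·r K)` (`core_of_coreZero_mgfForm` at `0 < F.side ^ 4`). [folklore] -/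
theorem core_readingV₁₃_of_coreZero_of_shapeDensity_linear (E : B12.RunParams → ℝ) (hsel : θ.ppSel = ppSelLiveOfRecord F N θ.ν θ.τ9 E (wOfRecord₉ F N θ.toStage9Params))
    (hζm : ZetaMeasurable F N θ.ζ) (hζ0 : ∀ p g k s Pl Ql RS U V', 0 ≤ θ.ζ p g k s Pl Ql RS U V') (g₀ : ℕ → ℝ) (os : List (ULoop F)) {δ₀ r : ℕ → ℝ}
    (h0 : letI : DecidableEq (Σ K, SiteSeqKey F (K₀ + K)) := Classical.decEq _
      NE7.Core 1 ((F.side : ℝ) ^ 4) (classSet₁₃ θ K₀ g₀) (badClass₁₃ θ K₀ g₀ jcut) (fun K _ x => weightA₁₃ θ hP K₀ g₀ os K 0 x - (sh F θ hP g₀ os).1 K 0 x)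
        (fun K _ x => weightB₁₃ θ hP K₀ g₀ os K 0 x - (sh F θ hP g₀ os).2 K 0 x) δ₀)
    {νshA : ∀ K, (Σ K, SiteSeqKey F (K₀ + K)) → Measure (GaugeField (F.P (K₀ + K)) 0 (Node00.SU N))}
    {νshB : ∀ K, (Σ K, SiteSeqKey F (K₀ + K)) → Measure (GaugeField (F.P (K₀ + K + 1)) 0 (Node00.SU N))}
    (hshA : MGFForm 1 (classSet₁₃ θ K₀ g₀)
      (fun K (U : GaugeField (F.P (K₀ + K)) 0 (Node00.SU N)) => T4GenFunBounds.prodObs ((datumOfRecord₁₃CoPH F N θ hP).scheme g₀) (K₀ + K) os U) νshA (sh F θ hP g₀ os).1)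
    (hleA : ∀ K, ∀ x ∈ classSet₁₃ θ K₀ g₀ K, νshA K x ≤ classMeasA₁₃ θ K₀ g₀ K x)
    (hshB : MGFForm 1 (classSet₁₃ θ K₀ g₀)
      (fun K (U : GaugeField (F.P (K₀ + K + 1)) 0 (Node00.SU N)) => T4GenFunBounds.prodObs ((datumOfRecord₁₃CoPH F N θ hP).scheme g₀) (K₀ + K + 1) os U) νshB (sh F θ hP g₀ os).2)
    (hleB : ∀ K, ∀ x ∈ classSet₁₃ θ K₀ g₀ K, νshB K x ≤ classMeasB₁₃ θ K₀ g₀ K x)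
    (hSh : letI : DecidableEq (Σ K, SiteSeqKey F (K₀ + K)) := Classical.decEq _
      ∀ (K : ℕ) (t : ℝ), |t| ≤ 1 → ∀ x ∈ classSet₁₃ θ K₀ g₀ K \ badClass₁₃ θ K₀ g₀ jcut K t,
        ∃ (c : ℝ) (g : GaugeField (F.P 0) 0 (Node00.SU N) → ℝ), Measurable g ∧ (∀ u, |g u| ≤ r K) ∧
          (classMeasB₁₃ θ K₀ g₀ K x - νshB K x).map
              ((T4RunLadder.unitFactorisation (datumOfRecord₁₃CoPH F N θ hP) (isPrintedAveraged_datumOfRecord₁₃CoPH F N θ hP).avgMeasurable g₀).A (K₀ + K + 1)) =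
            ENNReal.ofReal (Real.exp c) •
              ((classMeasA₁₃ θ K₀ g₀ K x - νshA K x).map
                ((T4RunLadder.unitFactorisation (datumOfRecord₁₃CoPH F N θ hP) (isPrintedAveraged_datumOfRecord₁₃CoPH F N θ hP).avgMeasurable g₀).A (K₀ + K))).withDensity
                fun u => ENNReal.ofReal (Real.exp (g u)))
    (hr : ∀ K, 0 ≤ r K) :
    letI : DecidableEq (Σ K, SiteSeqKey F (K₀ + K)) := Classical.decEq _
    NE7.Core 1 ((F.side : ℝ) ^ 4) (classSet₁₃ θ K₀ g₀) (badClass₁₃ θ K₀ g₀ jcut) (fun K t x => weightA₁₃ θ hP K₀ g₀ os K t x - (sh F θ hP g₀ os).1 K t x)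
      (fun K t x => weightB₁₃ θ hP K₀ g₀ os K t x - (sh F θ hP g₀ os).2 K t x) fun K => δ₀ K + 1 / (F.side : ℝ) ^ 4 * r K := by
  letI : DecidableEq (Σ K, SiteSeqKey F (K₀ + K)) := Classical.decEq _
  have hA := (mgfForm_weightA₁₃ θ K₀ hP E hsel hζm hζ0 g₀ os).sub hshA hleA
  have hB := (mgfForm_weightB₁₃ θ K₀ hP E hsel hζm hζ0 g₀ os).sub hshB hleB
  have h := tiltedMeanMatching_of_shapeDensity_atKeys_linear (T := classSet₁₃ θ K₀ g₀) (Bad := badClass₁₃ θ K₀ g₀ jcut) (l₀ := 1) (r := r)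
    (kA := fun K => K₀ + K) (kB := fun K => K₀ + K + 1) (νA := fun K x => classMeasA₁₃ θ K₀ g₀ K x - νshA K x) (νB := fun K x => classMeasB₁₃ θ K₀ g₀ K x - νshB K x)
    (T4RunLadder.unitFactorisation (datumOfRecord₁₃CoPH F N θ hP) (isPrintedAveraged_datumOfRecord₁₃CoPH F N θ hP).avgMeasurable g₀) os hA.finite hSh hr
  have hη : TiltedMeanMatching 1 (classSet₁₃ θ K₀ g₀) (badClass₁₃ θ K₀ g₀ jcut)
      (fun K (U : GaugeField (F.P (K₀ + K)) 0 (Node00.SU N)) => T4GenFunBounds.prodObs ((datumOfRecord₁₃CoPH F N θ hP).scheme g₀) (K₀ + K) os U)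
      (fun K x => classMeasA₁₃ θ K₀ g₀ K x - νshA K x)
      (fun K (U : GaugeField (F.P (K₀ + K + 1)) 0 (Node00.SU N)) => T4GenFunBounds.prodObs ((datumOfRecord₁₃CoPH F N θ hP).scheme g₀) (K₀ + K + 1) os U)
      (fun K x => classMeasB₁₃ θ K₀ g₀ K x - νshB K x) r := by
    intro K t ht x hx u hu
    exact h K t ht x hx u hu
  exact core_of_coreZero_mgfForm (pow_pos F.side_pos 4) hA hB h0 hη

end CoreShape

/-! ## §2′ ∕ §3 At n21-d's shell split of record `shellSplitOfRecord₁₃At N K₀ ρA ρB`: (SH) discharged; then MASS_cl ∧ SHAPE_cl on the (I)-road, width `r₁ + r₂` -/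

section ShellOfRecord

open Summit.QuantumFields.YangMills.Theorems.N21ShellSplitOfRecord13CoPH (shellA₁₃ shellB₁₃ shellSplitOfRecord₁₃At WidthLetter₁₃CoPH)
open YMDAG.N14.AtSpineReading13CoPH.Shell

/-- **★ THE (I)-ROAD CORE AT THE V READING `crOfRecord₁₃VAt K₀ jcut (shellSplitOfRecord₁₃At N K₀ ρA ρB)`'s CARRIERS, SHAPE CURRENCY, RATE DISPLAYED, (SH) DISCHARGED** — §2's V edition
with the MGF-part form of n21-d's shell split of record supplied BY NAME by the shell sibling p594686 (`mgfForm_shellA₁₃ ∕ shellMeasA₁₃_le ∕ mgfForm_shellB₁₃ ∕ shellMeasB₁₃_le`), any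
width letters `ρA ρB`: (V) `δ₀` + (I) SHAPE_cl(`r`) on the shell-free class laws of record ⇒ `NE7.Core 1 (F.side⁴) … (weightA₁₃ − shellA₁₃) (weightB₁₃ − shellB₁₃) (K ↦ δ₀ K +
(1 ∕ F.side⁴)·r K)`. [folklore] -/
theorem core_readingV₁₃_shellSplitOfRecord_of_coreZero_of_shapeDensity_linear (ρA ρB : WidthLetter₁₃CoPH N)
    (E : B12.RunParams → ℝ) (hsel : θ.ppSel = ppSelLiveOfRecord F N θ.ν θ.τ9 E (wOfRecord₉ F N θ.toStage9Params))
    (hζm : ZetaMeasurable F N θ.ζ) (hζ0 : ∀ p g k s Pl Ql RS U V', 0 ≤ θ.ζ p g k s Pl Ql RS U V') (g₀ : ℕ → ℝ) (os : List (ULoop F)) {δ₀ r : ℕ → ℝ}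
    (h0 : letI : DecidableEq (Σ K, SiteSeqKey F (K₀ + K)) := Classical.decEq _
      NE7.Core 1 ((F.side : ℝ) ^ 4) (classSet₁₃ θ K₀ g₀) (badClass₁₃ θ K₀ g₀ jcut)
        (fun K _ x => weightA₁₃ θ hP K₀ g₀ os K 0 x - shellA₁₃ θ hP K₀ g₀ os (ρA F θ hP g₀ os) K 0 x)
        (fun K _ x => weightB₁₃ θ hP K₀ g₀ os K 0 x - shellB₁₃ θ hP K₀ g₀ os (ρB F θ hP g₀ os) K 0 x) δ₀)
    (hSh : letI : DecidableEq (Σ K, SiteSeqKey F (K₀ + K)) := Classical.decEq _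
      ∀ (K : ℕ) (t : ℝ), |t| ≤ 1 → ∀ x ∈ classSet₁₃ θ K₀ g₀ K \ badClass₁₃ θ K₀ g₀ jcut K t,
        ∃ (c : ℝ) (g : GaugeField (F.P 0) 0 (Node00.SU N) → ℝ), Measurable g ∧ (∀ u, |g u| ≤ r K) ∧
          (classMeasB₁₃ θ K₀ g₀ K x - shellMeasB₁₃ θ K₀ g₀ (ρB F θ hP g₀ os) K x).map
              ((T4RunLadder.unitFactorisation (datumOfRecord₁₃CoPH F N θ hP) (isPrintedAveraged_datumOfRecord₁₃CoPH F N θ hP).avgMeasurable g₀).A (K₀ + K + 1)) =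
            ENNReal.ofReal (Real.exp c) •
              ((classMeasA₁₃ θ K₀ g₀ K x - shellMeasA₁₃ θ K₀ g₀ (ρA F θ hP g₀ os) K x).map
                ((T4RunLadder.unitFactorisation (datumOfRecord₁₃CoPH F N θ hP) (isPrintedAveraged_datumOfRecord₁₃CoPH F N θ hP).avgMeasurable g₀).A (K₀ + K))).withDensity
                fun u => ENNReal.ofReal (Real.exp (g u)))
    (hr : ∀ K, 0 ≤ r K) :
    letI : DecidableEq (Σ K, SiteSeqKey F (K₀ + K)) := Classical.decEq _
    NE7.Core 1 ((F.side : ℝ) ^ 4) (classSet₁₃ θ K₀ g₀) (badClass₁₃ θ K₀ g₀ jcut)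
      (fun K t x => weightA₁₃ θ hP K₀ g₀ os K t x - shellA₁₃ θ hP K₀ g₀ os (ρA F θ hP g₀ os) K t x)
      (fun K t x => weightB₁₃ θ hP K₀ g₀ os K t x - shellB₁₃ θ hP K₀ g₀ os (ρB F θ hP g₀ os) K t x) fun K => δ₀ K + 1 / (F.side : ℝ) ^ 4 * r K :=
  core_readingV₁₃_of_coreZero_of_shapeDensity_linear θ hP K₀ jcut (shellSplitOfRecord₁₃At N K₀ ρA ρB) E hsel hζm hζ0 g₀ os h0
    (mgfForm_shellA₁₃ θ K₀ hP E hsel hζm hζ0 g₀ os (ρA F θ hP g₀ os)) (fun K x _ => shellMeasA₁₃_le θ K₀ hζm g₀ (ρA F θ hP g₀ os) K x)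
    (mgfForm_shellB₁₃ θ K₀ hP E hsel hζm hζ0 g₀ os (ρB F θ hP g₀ os)) (fun K x _ => shellMeasB₁₃_le θ K₀ hζm g₀ (ρB F θ hP g₀ os) K x) hSh hr

/-- **★★ MASS_cl ∧ SHAPE_cl ON N14's (I)-ROAD AT THE V READING WITH n21-d's SHELL SPLIT OF RECORD — EXPONENT WIDTH `r₁ + r₂`.**  The SAME displayed inputs as g3 FILE 1 §4's
`core_crOfRecord₁₃VAt_shellSplitOfRecord_of_massSandwich_of_shapeDensity` (each produced by nobody): `hM` = MASS_cl(`r₁`) of the SHELL-FREE class measures of record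
`classMeasA₁₃ − shellMeasA₁₃ ρA ∕ classMeasB₁₃ − shellMeasB₁₃ ρB` (ONE constant per `K`, mass form) and `hSh` = SHAPE_cl(`r₂`) in density form for the same laws pushed to the unit
lattice, `0 ≤ r₂ K`.  CONCLUSION on the (I)-road: §0 turns `hM` into the vacuum bracket of width `r₁ ∕ F.side⁴`, §1's LINEAR binder reads `hSh` at rate `r₂`, dag-n19-d's join adds
them ⇒ `NE7.Core 1 (F.side⁴) … (weightA₁₃ − shellA₁₃) (weightB₁₃ − shellB₁₃) (K ↦ (r₁ K + r₂ K) ∕ F.side⁴)`, i.e. `e^{c ∓ (r₁ + r₂)}` sandwiches at every admissible source.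
Road (iii)″ — dag-n19-c's `classSandwich_of_mass_of_shape` (NE7-S_cl of width `r₁ + 2r₂`) ∘ `core_of_classSandwich`, the road that does NOT read N14's binder — displays `r₁ + 2r₂`
from the same inputs: in SHAPE currency the (I)-binder road is the tighter typed road (by `r₂`).  The canonical-`δ` ∕ `Summable` literal K3⁷ reads is g3 FILE 1 §4's and is not
re-typed. [folklore] -/
theorem core_readingV₁₃_shellSplitOfRecord_of_massSandwich_of_shapeDensity_linear (ρA ρB : WidthLetter₁₃CoPH N)
    (E : B12.RunParams → ℝ) (hsel : θ.ppSel = ppSelLiveOfRecord F N θ.ν θ.τ9 E (wOfRecord₉ F N θ.toStage9Params))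
    (hζm : ZetaMeasurable F N θ.ζ) (hζ0 : ∀ p g k s Pl Ql RS U V', 0 ≤ θ.ζ p g k s Pl Ql RS U V') (g₀ : ℕ → ℝ) (os : List (ULoop F)) {r₁ r₂ : ℕ → ℝ}
    (hM : letI : DecidableEq (Σ K, SiteSeqKey F (K₀ + K)) := Classical.decEq _
      ∀ K : ℕ, ∃ c : ℝ, ∀ t : ℝ, |t| ≤ 1 → ∀ x ∈ classSet₁₃ θ K₀ g₀ K \ badClass₁₃ θ K₀ g₀ jcut K t,
        ENNReal.ofReal (Real.exp (c - r₁ K)) * (classMeasA₁₃ θ K₀ g₀ K x - shellMeasA₁₃ θ K₀ g₀ (ρA F θ hP g₀ os) K x) Set.univ ≤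
            (classMeasB₁₃ θ K₀ g₀ K x - shellMeasB₁₃ θ K₀ g₀ (ρB F θ hP g₀ os) K x) Set.univ ∧
          (classMeasB₁₃ θ K₀ g₀ K x - shellMeasB₁₃ θ K₀ g₀ (ρB F θ hP g₀ os) K x) Set.univ ≤
            ENNReal.ofReal (Real.exp (c + r₁ K)) * (classMeasA₁₃ θ K₀ g₀ K x - shellMeasA₁₃ θ K₀ g₀ (ρA F θ hP g₀ os) K x) Set.univ)
    (hSh : letI : DecidableEq (Σ K, SiteSeqKey F (K₀ + K)) := Classical.decEq _
      ∀ (K : ℕ) (t : ℝ), |t| ≤ 1 → ∀ x ∈ classSet₁₃ θ K₀ g₀ K \ badClass₁₃ θ K₀ g₀ jcut K t,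
        ∃ (c : ℝ) (g : GaugeField (F.P 0) 0 (Node00.SU N) → ℝ), Measurable g ∧ (∀ u, |g u| ≤ r₂ K) ∧
          (classMeasB₁₃ θ K₀ g₀ K x - shellMeasB₁₃ θ K₀ g₀ (ρB F θ hP g₀ os) K x).map
              ((T4RunLadder.unitFactorisation (datumOfRecord₁₃CoPH F N θ hP) (isPrintedAveraged_datumOfRecord₁₃CoPH F N θ hP).avgMeasurable g₀).A (K₀ + K + 1)) =
            ENNReal.ofReal (Real.exp c) •
              ((classMeasA₁₃ θ K₀ g₀ K x - shellMeasA₁₃ θ K₀ g₀ (ρA F θ hP g₀ os) K x).map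
                ((T4RunLadder.unitFactorisation (datumOfRecord₁₃CoPH F N θ hP) (isPrintedAveraged_datumOfRecord₁₃CoPH F N θ hP).avgMeasurable g₀).A (K₀ + K))).withDensity
                fun u => ENNReal.ofReal (Real.exp (g u)))
    (hr₂ : ∀ K, 0 ≤ r₂ K) :
    letI : DecidableEq (Σ K, SiteSeqKey F (K₀ + K)) := Classical.decEq _
    NE7.Core 1 ((F.side : ℝ) ^ 4) (classSet₁₃ θ K₀ g₀) (badClass₁₃ θ K₀ g₀ jcut)
      (fun K t x => weightA₁₃ θ hP K₀ g₀ os K t x - shellA₁₃ θ hP K₀ g₀ os (ρA F θ hP g₀ os) K t x)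
      (fun K t x => weightB₁₃ θ hP K₀ g₀ os K t x - shellB₁₃ θ hP K₀ g₀ os (ρB F θ hP g₀ os) K t x) fun K => (r₁ K + r₂ K) / (F.side : ℝ) ^ 4 := by
  letI : DecidableEq (Σ K, SiteSeqKey F (K₀ + K)) := Classical.decEq _
  have hA := (mgfForm_weightA₁₃ θ K₀ hP E hsel hζm hζ0 g₀ os).sub
    (mgfForm_shellA₁₃ θ K₀ hP E hsel hζm hζ0 g₀ os (ρA F θ hP g₀ os)) (fun K x _ => shellMeasA₁₃_le θ K₀ hζm g₀ (ρA F θ hP g₀ os) K x)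
  have hB := (mgfForm_weightB₁₃ θ K₀ hP E hsel hζm hζ0 g₀ os).sub
    (mgfForm_shellB₁₃ θ K₀ hP E hsel hζm hζ0 g₀ os (ρB F θ hP g₀ os)) (fun K x _ => shellMeasB₁₃_le θ K₀ hζm g₀ (ρB F θ hP g₀ os) K x)
  -- (V) from MASS_cl, width `r₁ ∕ F.side⁴`
  have h0 : NE7.Core 1 ((F.side : ℝ) ^ 4) (classSet₁₃ θ K₀ g₀) (badClass₁₃ θ K₀ g₀ jcut)
      (fun K _ x => weightA₁₃ θ hP K₀ g₀ os K 0 x - shellA₁₃ θ hP K₀ g₀ os (ρA F θ hP g₀ os) K 0 x)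
      (fun K _ x => weightB₁₃ θ hP K₀ g₀ os K 0 x - shellB₁₃ θ hP K₀ g₀ os (ρB F θ hP g₀ os) K 0 x) (fun K => r₁ K / (F.side : ℝ) ^ 4) :=
    coreZero_of_massSandwich_mgfForm (pow_pos F.side_pos 4) hA hB hM
  -- (I) at the linear rate `r₂`
  have h := tiltedMeanMatching_of_shapeDensity_atKeys_linear (T := classSet₁₃ θ K₀ g₀) (Bad := badClass₁₃ θ K₀ g₀ jcut) (l₀ := 1) (r := r₂)
    (kA := fun K => K₀ + K) (kB := fun K => K₀ + K + 1)
    (νA := fun K x => classMeasA₁₃ θ K₀ g₀ K x - shellMeasA₁₃ θ K₀ g₀ (ρA F θ hP g₀ os) K x)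
    (νB := fun K x => classMeasB₁₃ θ K₀ g₀ K x - shellMeasB₁₃ θ K₀ g₀ (ρB F θ hP g₀ os) K x)
    (T4RunLadder.unitFactorisation (datumOfRecord₁₃CoPH F N θ hP) (isPrintedAveraged_datumOfRecord₁₃CoPH F N θ hP).avgMeasurable g₀) os hA.finite hSh hr₂
  have hη : TiltedMeanMatching 1 (classSet₁₃ θ K₀ g₀) (badClass₁₃ θ K₀ g₀ jcut)
      (fun K (U : GaugeField (F.P (K₀ + K)) 0 (Node00.SU N)) => T4GenFunBounds.prodObs ((datumOfRecord₁₃CoPH F N θ hP).scheme g₀) (K₀ + K) os U)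
      (fun K x => classMeasA₁₃ θ K₀ g₀ K x - shellMeasA₁₃ θ K₀ g₀ (ρA F θ hP g₀ os) K x)
      (fun K (U : GaugeField (F.P (K₀ + K + 1)) 0 (Node00.SU N)) => T4GenFunBounds.prodObs ((datumOfRecord₁₃CoPH F N θ hP).scheme g₀) (K₀ + K + 1) os U)
      (fun K x => classMeasB₁₃ θ K₀ g₀ K x - shellMeasB₁₃ θ K₀ g₀ (ρB F θ hP g₀ os) K x) r₂ := by
    intro K t ht x hx u hu
    exact h K t ht x hx u hu
  -- the join: `δ = r₁ ∕ F.side⁴ + (1 ∕ F.side⁴)·r₂ = (r₁ + r₂) ∕ F.side⁴`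
  have hc : NE7.Core 1 ((F.side : ℝ) ^ 4) (classSet₁₃ θ K₀ g₀) (badClass₁₃ θ K₀ g₀ jcut)
      (fun K t x => weightA₁₃ θ hP K₀ g₀ os K t x - shellA₁₃ θ hP K₀ g₀ os (ρA F θ hP g₀ os) K t x)
      (fun K t x => weightB₁₃ θ hP K₀ g₀ os K t x - shellB₁₃ θ hP K₀ g₀ os (ρB F θ hP g₀ os) K t x)
      (fun K => r₁ K / (F.side : ℝ) ^ 4 + 1 / (F.side : ℝ) ^ 4 * r₂ K) :=
    core_of_coreZero_mgfForm (pow_pos F.side_pos 4) hA hB h0 hη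
  have e : (fun K => r₁ K / (F.side : ℝ) ^ 4 + 1 / (F.side : ℝ) ^ 4 * r₂ K) = fun K => (r₁ K + r₂ K) / (F.side : ℝ) ^ 4 :=
    funext fun K => by ring
  rw [e] at hc
  exact hc

end ShellOfRecord

end YMDAG.N14.AtSpineReading13CoPH.SharpShape

end
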